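import Literature.AlgebraicGeometry.Milne1999.HodgeGroupCMTorus
import Literature.AlgebraicGeometry.Milne1999.LefschetzGroupCommutativeIffCMType
import Literature.AlgebraicGeometry.Milne1999.MumfordTateGroupPowersMulEquiv
import Literature.AlgebraicGeometry.Milne1999.SpecialLefschetzGroupOneIsogenyFactors
import Literature.AlgebraicGeometry.Milne1999.CMTypeSimpleIsogenyFactors
import Literature.AlgebraicGeometry.Motives.AbelianVarietyIsogenyCancellation
import HarnessLib

/-!
# Isotypic products: the Lefschetz, special Lefschetz, Mumford–Tate and Hodge groups of `X₀ × ⋯ × X_n` with every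
# `X_i` isogenous to one abelian variety `B` are those of `B` (Milne 1999, Prop. 1.5 / Cor. 4.7 with ONE isogeny type)

Family `hodge`, layer `Literature/AlgebraicGeometry/Milne1999`, namespace `Literature.AlgebraicGeometry.Milne1999`.
THEOREMS ONLY (no definition, no named fact; D-0026 net debt 0).

Milne [Milne1999LefschetzClasses, Prop. 1.5 (p. 644)]: «An isogeny `A → A₁^{r₁} × ⋯ × A_s^{r_s}` with the `A_i` simple
and pairwise nonisogenous defines isomorphisms `C(A) ≅ ∏ M_{r_i}(C(A_i))`, `G(A) ≅ ∏ G(A_i)`, `S(A) ≅ ∏ S(A_i)`» and Cor. 4.7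
(p. 660) «… an isomorphism `(L(A), l(A)) → ∏ (L(A_i), l(A_i))`»; §1 p. 644: «`C(A)`, `G(A)`, `S(A)` depend only on the isogeny
class of `A`».  The ISOTYPIC case — a single isogeny type `B` (not assumed simple): a product `X = X₀ × ⋯ × X_n` of abelian
varieties EACH ISOGENOUS TO `B` is isogenous to the power `B^{n+1}` (§1, `isIsogenous_biproduct_powSucc_of_forall`,
from the tree's isogeny calculus `IsIsogenous.biproduct` and `A^{n+1} ≅ ⨁_{Fin (n+1)} A`), so every isogeny-and-power
invariant of the tree is read off `B` (§2): `L(X)(ℂ) ≅ L(B)(ℂ)`, `ker l(X)(ℂ) ≅ ker l(B)(ℂ)`, `MT(X)(ℂ) ≅ MT(B)(ℂ)`,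
`Hg′(X)(ℂ) ≅ Hg′(B)(ℂ)` (and on `H¹`), Milne's Prop. 4.8 conditions `Hg′ = ker l`, `MT = L` hold for `X` iff for `B`,
`X` is stably nondegenerate iff `B` is, `X` is of CM-type iff `B` is, `L(X)(ℂ)` is commutative iff `L(B)(ℂ)` is; the
two-factor case `X × Y`, `X ∼ B ∼ Y` (§3).  §4 puts in the CM torus of `Milne1999/LefschetzGroupCMTorus`: if `B` realises a
CM type `(K; Φ)` with `θ(K) ⊆ C(B)`, then `L(X)(ℂ) ≃* (Φ → ℂˣ) × ℂˣ` and `ker l(X)(ℂ) ≃* (Φ → ℂˣ)` for every such isotypic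
`X` («`L(A_Ψ) = T^Ψ`», [Milne1999, §2 Prop. 2.5], read for `A ∼ A_Φ^{n+1}`); `Hg′(X)(ℂ)` and `MT(X)(ℂ)` are commutative
(Deligne I §5, through `Milne1999/HodgeGroupCMTorus` — no hypothesis on `θ(K)`), and for a NONDEGENERATE type
`Hg′(X)(ℂ) ≃* (Φ → ℂˣ)`, `MT(X)(ℂ) ≃* (Φ → ℂˣ) × ℂˣ`, `X` stably nondegenerate (Kubota / Hazama, Gordon Thm. 6.4, for the
isotypic `X`; for a PRIMITIVE type `X` is stably nondegenerate iff `Φ` is nondegenerate).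

## Sources read, verbatim

* J. S. Milne, *Lefschetz classes on abelian varieties*, Duke Math. J. 96 (1999) [`paper:doi-10-1215-s0012-7094-99-09620-5`],
  §1 p. 644 («It follows that … `C(A)`, `G(A)`, `S(A)` … depend only on the isogeny class of `A`»; Prop. 1.5), §4 p. 660
  (Cor. 4.7, Prop. 4.8).
* J. S. Milne, *Lefschetz motives and the Tate conjecture*, Compositio Math. 117 (1999) [`paper:doi-10-1023-a-1000776613765`],
  §2 Prop. 2.5.
* B. Moonen, Yu. Zarhin, *Hodge classes on abelian varieties of low dimension*, Math. Ann. 315 (1999), §1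
  («`Hg(X₁^{n₁} × X₂^{n₂}) = Hg(X₁ × X₂)`», isogeny invariance); B. B. Gordon, *A survey of the Hodge conjecture for abelian
  varieties* (1999), 2.1.7, 2.2, Thm. 7.5, Def. 7.6.

## References

* [Milne1999LefschetzClasses] J. S. Milne, Lefschetz classes on abelian varieties, Duke Math. J. 96 (1999): §1 p. 644, Prop. 1.5,
  Cor. 4.7, Prop. 4.8.
* [Milne1999] J. S. Milne, Lefschetz motives and the Tate conjecture, Compositio Math. 117 (1999): §2 Prop. 2.5.
* [MoonenZarhin1999LowDim] B. Moonen, Yu. Zarhin, Hodge classes on abelian varieties of low dimension (1999), §1.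
* [Gordon1999HodgeAVSurvey] B. B. Gordon, A survey of the Hodge conjecture for abelian varieties (1999), 2.1.7, 2.2, Thm. 6.4,
  7.5, 7.6, §9.4.
* [Deligne1982HodgeCycles] P. Deligne, Hodge cycles on abelian varieties, LNM 900 (1982), I §5 (CM-type; Prop. 5.1).
* [MumfordAV1970] D. Mumford, Abelian varieties (1970), §19.
-/

noncomputable section

open CategoryTheory CategoryTheory.Limits NumberField
open Literature.AlgebraicTopology.SingularHomology
open Literature.AlgebraicGeometry.HodgeTheory
open Literature.AlgebraicGeometry.Motives
open Literature.AlgebraicGeometry.ComplexMultiplication (IsCMTypeRealisation)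

namespace Literature.AlgebraicGeometry.Milne1999

variable {n : ℕ} {Xs : Fin (n + 1) → AbelianVariety ℂ} {B X Y : AbelianVariety ℂ}

/-! ### §1 An isotypic product is isogenous to a power -/

section Isogeny

/-- **`X₀ × ⋯ × X_n ∼ B^{n+1}` when every `X_i ∼ B`** (`⨁ X_i ∼ ⨁ B = B^{n+1}`; the tree's `IsIsogenous.biproduct` and
`A^{a+1} ≅ ⨁_{Fin (a+1)} A`). [cite: MumfordAV1970, §19 (isogeny is an equivalence relation; products)]
[cite: Milne1999LefschetzClasses, §1 p. 644] -/
theorem isIsogenous_biproduct_powSucc_of_forall (h : ∀ i, AbelianVariety.IsIsogenous (Xs i) B) :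
    AbelianVariety.IsIsogenous (⨁ Xs) (B.powSucc n) :=
  (AbelianVariety.IsIsogenous.biproduct h).trans (Pohlmann1968.isIsogenous_powSucc_biproduct B n).symm'

/-- **`X × Y ∼ B²` when `X ∼ B ∼ Y`** (`B.powSucc 1 = B × B`). [cite: MumfordAV1970, §19] -/
theorem isIsogenous_prod_powSucc_one (hX : AbelianVariety.IsIsogenous X B) (hY : AbelianVariety.IsIsogenous Y B) :
    AbelianVariety.IsIsogenous (X.prod Y) (B.powSucc 1) :=
  hX.prod hY

/-- An isotypic product of a positive-dimensional type has positive dimension (`dim` is an isogeny invariant,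
`dim B^{n+1} = (n+1) dim B`). [cite: MumfordAV1970, §19 (isogenies preserve dimension)] -/
theorem one_le_dim_biproduct_of_forall (hB : 1 ≤ B.dim) (h : ∀ i, AbelianVariety.IsIsogenous (Xs i) B) :
    1 ≤ (⨁ Xs).dim := by
  obtain ⟨f, hf⟩ := isIsogenous_biproduct_powSucc_of_forall h
  rw [AbelianVariety.dim_eq_of_isIsogeny hf]
  exact dim_powSucc_pos hB n

end Isogeny

/-! ### §2 The groups of an isotypic product `⨁ X_i`, `X_i ∼ B` -/

section Biproduct

/-- **`L(X₀ × ⋯ × X_n)(ℂ) ≅ L(B)(ℂ)`** for `X_i ∼ B` (`dim B ≥ 1`): Cor. 4.7 with one isogeny type.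
[cite: Milne1999LefschetzClasses, Prop. 1.5 (p. 644) and Cor. 4.7 (p. 660)] -/
theorem nonempty_lefschetzGroup_biproduct_mulEquiv_of_forall (hB : 1 ≤ B.dim)
    (h : ∀ i, AbelianVariety.IsIsogenous (Xs i) B) :
    Nonempty (lefschetzGroup (⨁ Xs).dim (⨁ Xs).X ≃* lefschetzGroup B.dim B.X) :=
  nonempty_lefschetzGroup_mulEquiv_of_isIsogenous_powSucc hB n (isIsogenous_biproduct_powSucc_of_forall h)

/-- **`ker l(X₀ × ⋯ × X_n)(ℂ) ≅ ker l(B)(ℂ)`** for `X_i ∼ B` (`dim B ≥ 1`): «`S(A) ≅ ∏ S(A_i)`» with one isogeny type.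
[cite: Milne1999LefschetzClasses, Prop. 1.5 (p. 644) and Cor. 4.7 (p. 660)] -/
theorem nonempty_specialLefschetzGroup_biproduct_mulEquiv_of_forall (hB : 1 ≤ B.dim)
    (h : ∀ i, AbelianVariety.IsIsogenous (Xs i) B) :
    Nonempty (specialLefschetzGroup (⨁ Xs).dim (⨁ Xs).X ≃* specialLefschetzGroup B.dim B.X) :=
  nonempty_specialLefschetzGroup_mulEquiv_of_isIsogenous_powSucc hB n (isIsogenous_biproduct_powSucc_of_forall h)

/-- **`MT(X₀ × ⋯ × X_n)(ℂ) ≅ MT(B)(ℂ)`** for `X_i ∼ B` (isogeny invariance and `MT(B^{n+1}) = MT(B)` diagonally).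
[cite: Gordon1999HodgeAVSurvey, 2.1.7 and 2.2] [cite: MoonenZarhin1999LowDim, §1] -/
theorem nonempty_mumfordTateGroup_biproduct_mulEquiv_of_forall (h : ∀ i, AbelianVariety.IsIsogenous (Xs i) B) :
    Nonempty (mumfordTateGroup (⨁ Xs).dim (⨁ Xs).X ≃* mumfordTateGroup B.dim B.X) :=
  nonempty_mumfordTateGroup_mulEquiv_of_isIsogenous_powSucc B n (isIsogenous_biproduct_powSucc_of_forall h)

/-- **`Hg′(X₀ × ⋯ × X_n)(ℂ) ≅ Hg′(B)(ℂ)`** for `X_i ∼ B` («`Hg(X₁^{n₁} × X₂^{n₂}) = Hg(X₁ × X₂)`» and isogeny invariance).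
[cite: MoonenZarhin1999LowDim, §1] [cite: Gordon1999HodgeAVSurvey, 2.1.7 and 2.2] -/
theorem nonempty_hodgeGroup_biproduct_mulEquiv_of_forall (h : ∀ i, AbelianVariety.IsIsogenous (Xs i) B) :
    Nonempty (hodgeGroup (⨁ Xs).dim (⨁ Xs).X ≃* hodgeGroup B.dim B.X) :=
  nonempty_hodgeGroup_mulEquiv_of_isIsogenous_powSucc (A := B) (r := n) (isIsogenous_biproduct_powSucc_of_forall h)

/-- `ker l(⨁ X_i)(ℂ)|_{H¹} ≅ ker l(B)(ℂ)|_{H¹}` for `X_i ∼ B` (`dim B ≥ 1`). [cite: Milne1999LefschetzClasses, Prop. 1.5 (p. 644) and Thm. 4.4] -/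
theorem nonempty_map_specialLefschetzGroup_one_biproduct_mulEquiv_of_forall (hB : 1 ≤ B.dim)
    (h : ∀ i, AbelianVariety.IsIsogenous (Xs i) B) :
    Nonempty (((specialLefschetzGroup (⨁ Xs).dim (⨁ Xs).X).map
        (Pi.evalMonoidHom (fun k : ℕ ↦ complexBetti (⨁ Xs).X k ≃ₗ[ℂ] complexBetti (⨁ Xs).X k) 1)) ≃*
      (specialLefschetzGroup B.dim B.X).map
        (Pi.evalMonoidHom (fun k : ℕ ↦ complexBetti B.X k ≃ₗ[ℂ] complexBetti B.X k) 1)) :=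
  nonempty_map_specialLefschetzGroup_one_mulEquiv_of_isIsogenous_powSucc (A := B) hB n
    (isIsogenous_biproduct_powSucc_of_forall h)

/-- `L(⨁ X_i)(ℂ)|_{H¹} ≅ L(B)(ℂ)|_{H¹}` for `X_i ∼ B` (`dim B ≥ 1`). [cite: Milne1999LefschetzClasses, Cor. 4.7 (p. 660) and Thm. 4.4] -/
theorem nonempty_map_lefschetzGroup_one_biproduct_mulEquiv_of_forall (hB : 1 ≤ B.dim)
    (h : ∀ i, AbelianVariety.IsIsogenous (Xs i) B) :
    Nonempty (((lefschetzGroup (⨁ Xs).dim (⨁ Xs).X).map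
        (Pi.evalMonoidHom (fun k : ℕ ↦ complexBetti (⨁ Xs).X k ≃ₗ[ℂ] complexBetti (⨁ Xs).X k) 1)) ≃*
      (lefschetzGroup B.dim B.X).map
        (Pi.evalMonoidHom (fun k : ℕ ↦ complexBetti B.X k ≃ₗ[ℂ] complexBetti B.X k) 1)) :=
  nonempty_map_lefschetzGroup_one_mulEquiv_of_isIsogenous_powSucc (A := B) hB n
    (isIsogenous_biproduct_powSucc_of_forall h)

/-- **Prop. 4.8 (c) for an isotypic product**: `Hg′(⨁ X_i) = ker l(⨁ X_i) ⟺ Hg′(B) = ker l(B)` (`X_i ∼ B`).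
[cite: Milne1999LefschetzClasses, Prop. 4.8 (p. 660), §1 p. 644 and Cor. 4.7] -/
theorem hodgeGroup_eq_specialLefschetzGroup_biproduct_iff_of_forall (h : ∀ i, AbelianVariety.IsIsogenous (Xs i) B) :
    hodgeGroup (⨁ Xs).dim (⨁ Xs).X = specialLefschetzGroup (⨁ Xs).dim (⨁ Xs).X ↔
      hodgeGroup B.dim B.X = specialLefschetzGroup B.dim B.X :=
  hodgeGroup_eq_specialLefschetzGroup_iff_of_isIsogenous_powSucc B n (isIsogenous_biproduct_powSucc_of_forall h)

/-- **Prop. 4.8 (b) for an isotypic product**: `MT(⨁ X_i) = L(⨁ X_i) ⟺ MT(B) = L(B)` (`X_i ∼ B`, `dim B ≥ 1`).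
[cite: Milne1999LefschetzClasses, Prop. 4.8 (p. 660) and Cor. 4.7] -/
theorem mumfordTateGroup_eq_lefschetzGroup_biproduct_iff_of_forall (hB : 1 ≤ B.dim)
    (h : ∀ i, AbelianVariety.IsIsogenous (Xs i) B) :
    mumfordTateGroup (⨁ Xs).dim (⨁ Xs).X = lefschetzGroup (⨁ Xs).dim (⨁ Xs).X ↔
      mumfordTateGroup B.dim B.X = lefschetzGroup B.dim B.X :=
  mumfordTateGroup_eq_lefschetzGroup_iff_of_isIsogenous_powSucc hB n (isIsogenous_biproduct_powSucc_of_forall h)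

/-- **Prop. 4.8 (a) for an isotypic product**: `⨁ X_i` is stably nondegenerate (no power supports an exotic Hodge class) iff
`B` is (`X_i ∼ B`). [cite: Milne1999LefschetzClasses, Prop. 4.8 (p. 660)] [cite: Gordon1999HodgeAVSurvey, Thm. 7.5 and Def. 7.6] -/
theorem isStablyNondegenerate_biproduct_iff_of_forall (h : ∀ i, AbelianVariety.IsIsogenous (Xs i) B) :
    IsStablyNondegenerate (⨁ Xs) ↔ IsStablyNondegenerate B :=
  (isStablyNondegenerate_iff_of_isIsogenous (isIsogenous_biproduct_powSucc_of_forall h)).trans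
    (isStablyNondegenerate_powSucc_iff B n)

/-- **An isotypic product is of CM-type iff its type is** (`X_i ∼ B`; CM-type is an isogeny invariant and passes to and
from powers). [cite: Milne1999, §2 p. 54] [cite: MumfordAV1970, §19 Remark p. 169] -/
theorem isOfCMType_biproduct_iff_of_forall (h : ∀ i, AbelianVariety.IsIsogenous (Xs i) B) :
    IsOfCMType (⨁ Xs) ↔ IsOfCMType B :=
  (isOfCMType_iff_of_isIsogenous (isIsogenous_biproduct_powSucc_of_forall h)).trans (isOfCMType_powSucc_iff n)

/-- `L(⨁ X_i)(ℂ)` is commutative iff `L(B)(ℂ)` is (`X_i ∼ B`; Prop. 1.5 shape, via CM-type).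
[cite: Milne1999LefschetzClasses, Prop. 1.5 (p. 644) and Cor. 4.7 (p. 660)] [cite: Deligne1982HodgeCycles, I §5] -/
theorem lefschetzGroup_biproduct_comm_iff_of_forall (h : ∀ i, AbelianVariety.IsIsogenous (Xs i) B) :
    (∀ g ∈ lefschetzGroup (⨁ Xs).dim (⨁ Xs).X, ∀ g' ∈ lefschetzGroup (⨁ Xs).dim (⨁ Xs).X, g * g' = g' * g) ↔
      ∀ g ∈ lefschetzGroup B.dim B.X, ∀ g' ∈ lefschetzGroup B.dim B.X, g * g' = g' * g :=
  lefschetzGroup_comm_iff_of_isIsogenous_powSucc n (isIsogenous_biproduct_powSucc_of_forall h)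

/-- `ker l(⨁ X_i)(ℂ)` is commutative iff `ker l(B)(ℂ)` is (`X_i ∼ B`). [cite: Milne1999LefschetzClasses, Prop. 1.5 (p. 644)]
[cite: Deligne1982HodgeCycles, I §5] -/
theorem specialLefschetzGroup_biproduct_comm_iff_of_forall (h : ∀ i, AbelianVariety.IsIsogenous (Xs i) B) :
    (∀ g ∈ specialLefschetzGroup (⨁ Xs).dim (⨁ Xs).X, ∀ g' ∈ specialLefschetzGroup (⨁ Xs).dim (⨁ Xs).X,
        g * g' = g' * g) ↔
      ∀ g ∈ specialLefschetzGroup B.dim B.X, ∀ g' ∈ specialLefschetzGroup B.dim B.X, g * g' = g' * g :=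
  (specialLefschetzGroup_comm_iff_of_isIsogenous (isIsogenous_biproduct_powSucc_of_forall h)).trans
    (specialLefschetzGroup_powSucc_comm_iff B n)

end Biproduct

/-! ### §3 Two factors: `X × Y` with `X ∼ B ∼ Y` -/

section TwoFactors

/-- **`L(X × Y)(ℂ) ≅ L(B)(ℂ)`** for `X ∼ B ∼ Y` (`dim B ≥ 1`). [cite: Milne1999LefschetzClasses, Prop. 1.5 (p. 644) and Cor. 4.7 (p. 660)] -/
theorem nonempty_lefschetzGroup_prod_mulEquiv_of_isIsogenous (hB : 1 ≤ B.dim) (hX : AbelianVariety.IsIsogenous X B)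
    (hY : AbelianVariety.IsIsogenous Y B) :
    Nonempty (lefschetzGroup (X.prod Y).dim (X.prod Y).X ≃* lefschetzGroup B.dim B.X) :=
  nonempty_lefschetzGroup_mulEquiv_of_isIsogenous_powSucc hB 1 (isIsogenous_prod_powSucc_one hX hY)

/-- **`ker l(X × Y)(ℂ) ≅ ker l(B)(ℂ)`** for `X ∼ B ∼ Y` (`dim B ≥ 1`). [cite: Milne1999LefschetzClasses, Prop. 1.5 (p. 644) and Cor. 4.7 (p. 660)] -/
theorem nonempty_specialLefschetzGroup_prod_mulEquiv_of_isIsogenous (hB : 1 ≤ B.dim)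
    (hX : AbelianVariety.IsIsogenous X B) (hY : AbelianVariety.IsIsogenous Y B) :
    Nonempty (specialLefschetzGroup (X.prod Y).dim (X.prod Y).X ≃* specialLefschetzGroup B.dim B.X) :=
  nonempty_specialLefschetzGroup_mulEquiv_of_isIsogenous_powSucc hB 1 (isIsogenous_prod_powSucc_one hX hY)

/-- **`MT(X × Y)(ℂ) ≅ MT(B)(ℂ)`** for `X ∼ B ∼ Y`. [cite: Gordon1999HodgeAVSurvey, 2.1.7 and 2.2] [cite: MoonenZarhin1999LowDim, §1] -/
theorem nonempty_mumfordTateGroup_prod_mulEquiv_of_isIsogenous (hX : AbelianVariety.IsIsogenous X B)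
    (hY : AbelianVariety.IsIsogenous Y B) :
    Nonempty (mumfordTateGroup (X.prod Y).dim (X.prod Y).X ≃* mumfordTateGroup B.dim B.X) :=
  nonempty_mumfordTateGroup_mulEquiv_of_isIsogenous_powSucc B 1 (isIsogenous_prod_powSucc_one hX hY)

/-- **`Hg′(X × Y)(ℂ) ≅ Hg′(B)(ℂ)`** for `X ∼ B ∼ Y` («`Hg(X₁^{n₁} × X₂^{n₂}) = Hg(X₁ × X₂)`», here `Hg(B²) = Hg(B)`).
[cite: MoonenZarhin1999LowDim, §1] [cite: Gordon1999HodgeAVSurvey, 2.1.7 and 2.2] -/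
theorem nonempty_hodgeGroup_prod_mulEquiv_of_isIsogenous (hX : AbelianVariety.IsIsogenous X B)
    (hY : AbelianVariety.IsIsogenous Y B) :
    Nonempty (hodgeGroup (X.prod Y).dim (X.prod Y).X ≃* hodgeGroup B.dim B.X) :=
  nonempty_hodgeGroup_mulEquiv_of_isIsogenous_powSucc (A := B) (r := 1) (isIsogenous_prod_powSucc_one hX hY)

/-- `Hg′(X × Y) = ker l(X × Y) ⟺ Hg′(B) = ker l(B)` for `X ∼ B ∼ Y`. [cite: Milne1999LefschetzClasses, Prop. 4.8 (p. 660) and Cor. 4.7] -/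
theorem hodgeGroup_eq_specialLefschetzGroup_prod_iff_of_isIsogenous (hX : AbelianVariety.IsIsogenous X B)
    (hY : AbelianVariety.IsIsogenous Y B) :
    hodgeGroup (X.prod Y).dim (X.prod Y).X = specialLefschetzGroup (X.prod Y).dim (X.prod Y).X ↔
      hodgeGroup B.dim B.X = specialLefschetzGroup B.dim B.X :=
  hodgeGroup_eq_specialLefschetzGroup_iff_of_isIsogenous_powSucc B 1 (isIsogenous_prod_powSucc_one hX hY)

/-- `MT(X × Y) = L(X × Y) ⟺ MT(B) = L(B)` for `X ∼ B ∼ Y` (`dim B ≥ 1`). [cite: Milne1999LefschetzClasses, Prop. 4.8 (p. 660) and Cor. 4.7] -/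
theorem mumfordTateGroup_eq_lefschetzGroup_prod_iff_of_isIsogenous (hB : 1 ≤ B.dim)
    (hX : AbelianVariety.IsIsogenous X B) (hY : AbelianVariety.IsIsogenous Y B) :
    mumfordTateGroup (X.prod Y).dim (X.prod Y).X = lefschetzGroup (X.prod Y).dim (X.prod Y).X ↔
      mumfordTateGroup B.dim B.X = lefschetzGroup B.dim B.X :=
  mumfordTateGroup_eq_lefschetzGroup_iff_of_isIsogenous_powSucc hB 1 (isIsogenous_prod_powSucc_one hX hY)

/-- `X × Y` is stably nondegenerate iff `B` is, for `X ∼ B ∼ Y`. [cite: Gordon1999HodgeAVSurvey, Thm. 7.5 and Def. 7.6]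
[cite: Milne1999LefschetzClasses, Prop. 4.8 (p. 660)] -/
theorem isStablyNondegenerate_prod_iff_of_isIsogenous (hX : AbelianVariety.IsIsogenous X B)
    (hY : AbelianVariety.IsIsogenous Y B) : IsStablyNondegenerate (X.prod Y) ↔ IsStablyNondegenerate B :=
  (isStablyNondegenerate_iff_of_isIsogenous (isIsogenous_prod_powSucc_one hX hY)).trans
    (isStablyNondegenerate_powSucc_iff B 1)

/-- `X × Y` is of CM-type iff `B` is, for `X ∼ B ∼ Y`. [cite: Milne1999, §2 p. 54] [cite: MumfordAV1970, §19 Remark p. 169] -/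
theorem isOfCMType_prod_iff_of_isIsogenous (hX : AbelianVariety.IsIsogenous X B) (hY : AbelianVariety.IsIsogenous Y B) :
    IsOfCMType (X.prod Y) ↔ IsOfCMType B :=
  (isOfCMType_iff_of_isIsogenous (isIsogenous_prod_powSucc_one hX hY)).trans (isOfCMType_powSucc_iff 1)

end TwoFactors

/-! ### §4 Isotypic products of CM type: the torus `T^Ψ` (Milne 1999b Prop. 2.5 for `A ∼ A_Φ^{n+1}`) -/

section CMTorus

variable {K : Type} [Field K] [NumberField K] [IsCMField K] {Φ : CMType K}
  {ι : 𝓞 K →+* End B} {θ : K →+* Module.End ℂ (complexBetti B.X 1)}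

omit [IsCMField K] in
/-- A realisation has positive dimension. [folklore] -/
private theorem one_le_dim_of_realisation (hB : IsCMTypeRealisation Φ B ι θ) : 1 ≤ B.dim := by
  have h1 := AbelianVariety.finrank_complexBetti_one B
  rw [hB.2.1] at h1
  have h2 : 0 < Module.finrank ℚ K := Module.finrank_pos
  omega

/-- **`L(X₀ × ⋯ × X_n)(ℂ) ≃* (ℂˣ)^Φ × ℂˣ`** for `X_i ∼ B`, `B` a realisation of the CM type `(K; Φ)` with `θ(K) ⊆ C(B)`:
«`(L(A_Ψ), l(A_Ψ)) = (T^Ψ, t^Ψ)`» for the isotypic `A ∼ A_Φ^{n+1}` (`L` depends only on the isogeny class and is diagonal on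
powers; `Milne1999/LefschetzGroupCMTorus`). [cite: Milne1999, §2 Prop. 2.5] [cite: Milne1999LefschetzClasses, Prop. 1.5 and Cor. 4.7] -/
theorem nonempty_lefschetzGroup_biproduct_mulEquiv_pi_units_prod (hB : IsCMTypeRealisation Φ B ι θ)
    (hθ : ∀ a : K, θ a ∈ centralizerAlgebra B) (h : ∀ i, AbelianVariety.IsIsogenous (Xs i) B) :
    Nonempty (lefschetzGroup (⨁ Xs).dim (⨁ Xs).X ≃* (Φ.1 → ℂˣ) × ℂˣ) := by
  obtain ⟨e₁⟩ := nonempty_lefschetzGroup_biproduct_mulEquiv_of_forall (one_le_dim_of_realisation hB) h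
  obtain ⟨e₂⟩ := nonempty_lefschetzGroup_mulEquiv_pi_units_prod hB hθ
  exact ⟨e₁.trans e₂⟩

/-- **`ker l(X₀ × ⋯ × X_n)(ℂ) ≃* (ℂˣ)^Φ`** for `X_i ∼ B`, `B` a CM realisation with `θ(K) ⊆ C(B)`.
[cite: Milne1999, §2 Prop. 2.5] [cite: Milne1999LefschetzClasses, Prop. 1.5 and §3 p. 657] -/
theorem nonempty_specialLefschetzGroup_biproduct_mulEquiv_pi_units (hB : IsCMTypeRealisation Φ B ι θ)
    (hθ : ∀ a : K, θ a ∈ centralizerAlgebra B) (h : ∀ i, AbelianVariety.IsIsogenous (Xs i) B) :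
    Nonempty (specialLefschetzGroup (⨁ Xs).dim (⨁ Xs).X ≃* (Φ.1 → ℂˣ)) := by
  obtain ⟨e₁⟩ := nonempty_specialLefschetzGroup_biproduct_mulEquiv_of_forall (one_le_dim_of_realisation hB) h
  obtain ⟨e₂⟩ := nonempty_specialLefschetzGroup_mulEquiv_pi_units hB hθ
  exact ⟨e₁.trans e₂⟩

/-- `L(⨁ X_i)(ℂ) ≃* (ℂˣ)^{dim B} × ℂˣ` — a split torus of rank `dim B + 1` — for an isotypic product of a CM type.
[cite: Milne1999, §2 Prop. 2.5] -/
theorem nonempty_lefschetzGroup_biproduct_mulEquiv_fin_prod (hB : IsCMTypeRealisation Φ B ι θ)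
    (hθ : ∀ a : K, θ a ∈ centralizerAlgebra B) (h : ∀ i, AbelianVariety.IsIsogenous (Xs i) B) :
    Nonempty (lefschetzGroup (⨁ Xs).dim (⨁ Xs).X ≃* (Fin B.dim → ℂˣ) × ℂˣ) := by
  obtain ⟨e₁⟩ := nonempty_lefschetzGroup_biproduct_mulEquiv_of_forall (one_le_dim_of_realisation hB) h
  obtain ⟨e₂⟩ := nonempty_lefschetzGroup_mulEquiv_fin_prod hB hθ
  exact ⟨e₁.trans e₂⟩

/-- `ker l(⨁ X_i)(ℂ) ≃* (ℂˣ)^{dim B}` — a split torus of rank `dim B` — for an isotypic product of a CM type.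
[cite: Milne1999, §2 Prop. 2.5] [cite: Milne1999LefschetzClasses, §3 p. 657] -/
theorem nonempty_specialLefschetzGroup_biproduct_mulEquiv_fin (hB : IsCMTypeRealisation Φ B ι θ)
    (hθ : ∀ a : K, θ a ∈ centralizerAlgebra B) (h : ∀ i, AbelianVariety.IsIsogenous (Xs i) B) :
    Nonempty (specialLefschetzGroup (⨁ Xs).dim (⨁ Xs).X ≃* (Fin B.dim → ℂˣ)) := by
  obtain ⟨e₁⟩ := nonempty_specialLefschetzGroup_biproduct_mulEquiv_of_forall (one_le_dim_of_realisation hB) h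
  obtain ⟨e₂⟩ := nonempty_specialLefschetzGroup_mulEquiv_fin hB hθ
  exact ⟨e₁.trans e₂⟩

/-- An isotypic product of a CM realisation is of CM-type (`B` is: `IsCMTypeRealisation.isOfCMType`-free form through
the commutativity of `L(B)(ℂ)`, `lefschetzGroup_comm_iff_isOfCMType`). [cite: Deligne1982HodgeCycles, I §5]
[cite: Milne1999, §1 Rem. 1.10 and §2 Prop. 2.5] -/
theorem isOfCMType_biproduct_of_isCMTypeRealisation (hB : IsCMTypeRealisation Φ B ι θ)
    (hθ : ∀ a : K, θ a ∈ centralizerAlgebra B) (h : ∀ i, AbelianVariety.IsIsogenous (Xs i) B) :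
    IsOfCMType (⨁ Xs) :=
  (isOfCMType_biproduct_iff_of_forall h).2
    ((lefschetzGroup_comm_iff_isOfCMType B).1 fun _ hg _ hg' ↦ lefschetzGroup_comm_of_isCMTypeRealisation hB hθ hg hg')

/-- **The Hodge group of an isotypic product of a CM abelian variety is commutative** (`X_i ∼ B`, `B` a CM realisation; no
hypothesis on `θ(K)`): `Hg′(⨁ X_i)(ℂ) ≅ Hg′(B)(ℂ) ↪ (ℂˣ)^Φ`. [cite: Deligne1982HodgeCycles, I §5 (CM-type; Prop. 5.1)]
[cite: MoonenZarhin1999LowDim, §1] -/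
theorem hodgeGroup_biproduct_comm_of_isCMTypeRealisation (hB : IsCMTypeRealisation Φ B ι θ)
    (h : ∀ i, AbelianVariety.IsIsogenous (Xs i) B)
    {g g' : ∀ k : ℕ, complexBetti (⨁ Xs).X k ≃ₗ[ℂ] complexBetti (⨁ Xs).X k} (hg : g ∈ hodgeGroup (⨁ Xs).dim (⨁ Xs).X)
    (hg' : g' ∈ hodgeGroup (⨁ Xs).dim (⨁ Xs).X) : g * g' = g' * g := by
  obtain ⟨e⟩ := nonempty_hodgeGroup_biproduct_mulEquiv_of_forall h
  have hc : e ⟨g, hg⟩ * e ⟨g', hg'⟩ = e ⟨g', hg'⟩ * e ⟨g, hg⟩ :=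
    Subtype.ext (hodgeGroup_comm_of_isCMTypeRealisation hB (e ⟨g, hg⟩).2 (e ⟨g', hg'⟩).2)
  rw [← map_mul, ← map_mul] at hc
  exact congrArg Subtype.val (e.injective hc)

/-- **The Mumford–Tate group of an isotypic product of a CM abelian variety is commutative** («of CM-type if its Mumford–Tate
group is commutative»; `X_i ∼ B`, no hypothesis on `θ(K)`). [cite: Deligne1982HodgeCycles, I §5 (CM-type; Prop. 5.1)]
[cite: Gordon1999HodgeAVSurvey, 2.1.7 and 2.2] -/
theorem mumfordTateGroup_biproduct_comm_of_isCMTypeRealisation (hB : IsCMTypeRealisation Φ B ι θ)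
    (h : ∀ i, AbelianVariety.IsIsogenous (Xs i) B)
    {m m' : ∀ k : ℕ, complexBetti (⨁ Xs).X k ≃ₗ[ℂ] complexBetti (⨁ Xs).X k}
    (hm : m ∈ mumfordTateGroup (⨁ Xs).dim (⨁ Xs).X) (hm' : m' ∈ mumfordTateGroup (⨁ Xs).dim (⨁ Xs).X) :
    m * m' = m' * m := by
  obtain ⟨e⟩ := nonempty_mumfordTateGroup_biproduct_mulEquiv_of_forall h
  have hc : e ⟨m, hm⟩ * e ⟨m', hm'⟩ = e ⟨m', hm'⟩ * e ⟨m, hm⟩ :=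
    Subtype.ext (mumfordTateGroup_comm_of_isCMTypeRealisation hB (e ⟨m, hm⟩).2 (e ⟨m', hm'⟩).2)
  rw [← map_mul, ← map_mul] at hc
  exact congrArg Subtype.val (e.injective hc)

/-- **An isotypic product of a NONDEGENERATE CM type is stably nondegenerate** (`X_i ∼ B`; Kubota / Hazama for `B`, the tree's
`Pohlmann1968.IsNondegenerate.isStablyNondegenerate`, and §2). [cite: Gordon1999HodgeAVSurvey, Thm. 6.4, Def. 7.6 and §9.4] -/
theorem isStablyNondegenerate_biproduct_of_isNondegenerate (hΦ : Pohlmann1968.IsNondegenerate Φ)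
    (hB : IsCMTypeRealisation Φ B ι θ) (h : ∀ i, AbelianVariety.IsIsogenous (Xs i) B) : IsStablyNondegenerate (⨁ Xs) :=
  (isStablyNondegenerate_biproduct_iff_of_forall h).2 (hΦ.isStablyNondegenerate hB)

/-- Nondegenerate type ⟹ `Hg′(⨁ X_i) = ker l(⨁ X_i)` for the isotypic `⨁ X_i`, `X_i ∼ B`. [cite: Gordon1999HodgeAVSurvey, Thm. 6.4 and §9.4]
[cite: Milne1999LefschetzClasses, Prop. 4.8 (p. 660)] -/
theorem hodgeGroup_eq_specialLefschetzGroup_biproduct_of_isNondegenerate (hΦ : Pohlmann1968.IsNondegenerate Φ)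
    (hB : IsCMTypeRealisation Φ B ι θ) (h : ∀ i, AbelianVariety.IsIsogenous (Xs i) B) :
    hodgeGroup (⨁ Xs).dim (⨁ Xs).X = specialLefschetzGroup (⨁ Xs).dim (⨁ Xs).X :=
  (hodgeGroup_eq_specialLefschetzGroup_biproduct_iff_of_forall h).2
    (hodgeGroup_eq_specialLefschetzGroup_of_isNondegenerate hΦ hB)

/-- **`Hg′(X₀ × ⋯ × X_n)(ℂ) ≃* (ℂˣ)^Φ` for an isotypic product of a NONDEGENERATE CM type** (`X_i ∼ B`, `θ(K) ⊆ C(B)`; «`dim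
Hg(A) = dim A`»). [cite: Gordon1999HodgeAVSurvey, Thm. 6.4 and §9.4] [cite: Milne1999, §2 Prop. 2.5] -/
theorem nonempty_hodgeGroup_biproduct_mulEquiv_pi_units_of_isNondegenerate (hΦ : Pohlmann1968.IsNondegenerate Φ)
    (hB : IsCMTypeRealisation Φ B ι θ) (hθ : ∀ a : K, θ a ∈ centralizerAlgebra B)
    (h : ∀ i, AbelianVariety.IsIsogenous (Xs i) B) :
    Nonempty (hodgeGroup (⨁ Xs).dim (⨁ Xs).X ≃* (Φ.1 → ℂˣ)) := by
  obtain ⟨e₁⟩ := nonempty_hodgeGroup_biproduct_mulEquiv_of_forall h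
  obtain ⟨e₂⟩ := nonempty_hodgeGroup_mulEquiv_pi_units_of_isNondegenerate hΦ hB hθ
  exact ⟨e₁.trans e₂⟩

/-- **`MT(X₀ × ⋯ × X_n)(ℂ) ≃* (ℂˣ)^Φ × ℂˣ` for an isotypic product of a NONDEGENERATE CM type** (`X_i ∼ B`, `θ(K) ⊆ C(B)`;
Kubota's rank `g + 1`). [cite: Gordon1999HodgeAVSurvey, Thm. 6.4 and §9.4] [cite: Milne1999, §2 Prop. 2.5] -/
theorem nonempty_mumfordTateGroup_biproduct_mulEquiv_pi_units_prod_of_isNondegenerate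
    (hΦ : Pohlmann1968.IsNondegenerate Φ) (hB : IsCMTypeRealisation Φ B ι θ) (hθ : ∀ a : K, θ a ∈ centralizerAlgebra B)
    (h : ∀ i, AbelianVariety.IsIsogenous (Xs i) B) :
    Nonempty (mumfordTateGroup (⨁ Xs).dim (⨁ Xs).X ≃* (Φ.1 → ℂˣ) × ℂˣ) := by
  obtain ⟨e₁⟩ := nonempty_mumfordTateGroup_biproduct_mulEquiv_of_forall h
  obtain ⟨e₂⟩ := nonempty_mumfordTateGroup_mulEquiv_pi_units_prod_of_isNondegenerate hΦ hB hθ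
  exact ⟨e₁.trans e₂⟩

/-- **Hazama's criterion for an isotypic product of a PRIMITIVE CM type**: `⨁ X_i` (`X_i ∼ B`) is stably nondegenerate iff
`Φ` is nondegenerate (the tree's `Pohlmann1968.isStablyNondegenerate_iff_isNondegenerate_of_primitive` for `B`, and §2).
[cite: Gordon1999HodgeAVSurvey, Thm. 6.4, Rem. 7.6.1 and §9.4] -/
theorem isStablyNondegenerate_biproduct_iff_isNondegenerate
    (hprim : ∀ s t : K →+* ℂ,
      (∀ τ : ℂ ≃+* ℂ, (τ : ℂ →+* ℂ).comp s ∈ Φ.1 ↔ (τ : ℂ →+* ℂ).comp t ∈ Φ.1) → s = t)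
    (hB : IsCMTypeRealisation Φ B ι θ) (h : ∀ i, AbelianVariety.IsIsogenous (Xs i) B) :
    IsStablyNondegenerate (⨁ Xs) ↔ Pohlmann1968.IsNondegenerate Φ :=
  (isStablyNondegenerate_biproduct_iff_of_forall h).trans
    (Pohlmann1968.isStablyNondegenerate_iff_isNondegenerate_of_primitive hprim hB)

/-- `Hg′(⨁ X_i) = ker l(⨁ X_i) ⟺ Φ nondegenerate`, for an isotypic product of a primitive CM type.
[cite: Gordon1999HodgeAVSurvey, Thm. 6.4 and §9.4] [cite: Milne1999LefschetzClasses, Prop. 4.8 (p. 660)] -/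
theorem hodgeGroup_eq_specialLefschetzGroup_biproduct_iff_isNondegenerate
    (hprim : ∀ s t : K →+* ℂ,
      (∀ τ : ℂ ≃+* ℂ, (τ : ℂ →+* ℂ).comp s ∈ Φ.1 ↔ (τ : ℂ →+* ℂ).comp t ∈ Φ.1) → s = t)
    (hB : IsCMTypeRealisation Φ B ι θ) (h : ∀ i, AbelianVariety.IsIsogenous (Xs i) B) :
    hodgeGroup (⨁ Xs).dim (⨁ Xs).X = specialLefschetzGroup (⨁ Xs).dim (⨁ Xs).X ↔ Pohlmann1968.IsNondegenerate Φ :=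
  (hodgeGroup_eq_specialLefschetzGroup_biproduct_iff_of_forall h).trans
    (hodgeGroup_eq_specialLefschetzGroup_iff_isNondegenerate hprim hB)

end CMTorus

end Literature.AlgebraicGeometry.Milne1999

end
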